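import Literature.Probability.Process.ItoCalculusProofs
import HarnessLib

/-!
# Local character of the Itô integral; Itô integrals of constants

Two complements to the Itô-integral interface `Literature.Probability.Process.IsItoIntegral`
(`Literature.Probability.Process.ItoCalculus`) for the canonical Brownian motion
`B = Literature.brownian` on `(ℝ≥0 → ℝ, preWienerMeasure)` with its raw natural filtration
`𝓕⁰ = Literature.brownianFiltration`:

* **local character** (`IsItoIntegral.ae_eqOn_of_brownian`): if two integrands `H, H'` (with
  a.s. Borel paths) admitting Itô integrals `K = ∫ H dB`, `K' = ∫ H' dB` agree on `[0, t]` for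
  every `ω` in a set `E` (no measurability of `E` is needed), then almost surely on `E`,
  `K_s = K'_s` for all `s ≤ t`. This is Revuz–Yor, Ch. IV, Prop. (2.11) ("if `H = K` on
  `[0, T] × E` … then `(H·M) = (K·M)` on `[0, T] × E` a.s.") for `M = B`, proved directly from
  the characterisation: along approximating sequences `Hₙ → H`, `Gₙ → H'`, the simple process
  `Hₙ - Gₙ` has small time integral on `E`, and the basic estimate of the construction,
  *localised to `E`* (`measure_inter_sup_integral_ge_le_brownian`: truncation at the level `η`
  of the time integral, Doob's inequality and the isometry for the truncated process), bounds
  `P(E ∩ {sup_{s ≤ t} |(Hₙ·B)_s - (Gₙ·B)_s| ≥ ε})`;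
* **constants** (`isItoIntegral_const_brownian`): the Itô integral of the constant integrand `c`
  is `c B` (the one-step simple processes `c 𝟙_{(0, n+1]}` approximate `c` exactly and their
  elementary integrals are `c B` on `[0, n+1]`).

Both are used for the localised Itô formula of the SLE–Bessel bridge
(`Literature.Analysis.FunctionSpaces.SLEBesselIto`: before the hitting time of `0`, the Itô
integral `∫ 2√Z f_ε'(Z) dB` of the cut-off square root is `B`).

## References

* D. Revuz, M. Yor, *Continuous Martingales and Brownian Motion* (3rd ed., 1999), Ch. IV,
  Prop. (2.11) (local character of `H·M`), Thm (2.12) and Prop. (2.13) (u.c.p. estimates by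
  truncation), eq. (2.4) and Prop. (2.10)(i).
-/

open MeasureTheory ProbabilityTheory Filter Finset
open scoped NNReal ENNReal Topology

noncomputable section

namespace Literature.Probability.Process

/-! ### The basic estimate of the construction, localised to an event -/

/-- **The basic u.c.p. estimate, localised to an arbitrary event `E`**: for a bounded simple `H`,
`ε, η > 0`,
`P(E ∩ {∃ s ≤ t, ε ≤ |(H·B)_s|}) ≤ P(E ∩ {η < ∫₀ᵗ H² ds}) + η / ε²`.
Same proof as `measure_sup_integral_ge_le_brownian` (on `{∫₀ᵗ H² ≤ η}` the integrals of `H` and of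
its truncation `H^η` agree; Doob's weak-`L²` inequality and the isometry for `H^η·B`), keeping
track of `E` in the first event only.
Revuz–Yor, *Continuous Martingales and Brownian Motion* (1999), Ch. IV, Thm (2.12) and
Prop. (2.13). [folklore] -/
theorem measure_inter_sup_integral_ge_le_brownian
    (H : SimpleProcess (inferInstance : MeasurableSpace (ℝ≥0 → ℝ)) RandomPlanarGeometry.brownianFiltration)
    (E : Set (ℝ≥0 → ℝ)) {ε η : ℝ} (hε : 0 < ε) (hη : 0 < η) (t : ℝ≥0) :
    preWienerMeasure (E ∩ {ω | ∃ s ≤ t, ε ≤ |H.integral brownian s ω|}) ≤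
      preWienerMeasure (E ∩ {ω | η < ∫ s in Set.Icc (0 : ℝ) t, (H.toProcess s.toNNReal ω) ^ 2}) +
        ENNReal.ofReal (η / ε ^ 2) := by
  haveI := RandomPlanarGeometry.isProbabilityMeasure_preWienerMeasure'
  set H' := H.truncate t η with hH'
  have hsub : E ∩ {ω | ∃ s ≤ t, ε ≤ |H.integral brownian s ω|} ⊆
      (E ∩ {ω | η < ∫ s in Set.Icc (0 : ℝ) t, (H.toProcess s.toNNReal ω) ^ 2}) ∪
        {ω | ∃ s ≤ t, ε ≤ |H'.integral brownian s ω|} := by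
    rintro ω ⟨hωE, s, hs, hεs⟩
    by_cases hω : ∫ s in Set.Icc (0 : ℝ) t, (H.toProcess s.toNNReal ω) ^ 2 ≤ η
    · refine Or.inr ⟨s, hs, ?_⟩
      rwa [hH', H.integral_truncate_eq t η brownian hω]
    · exact Or.inl ⟨hωE, not_le.1 hω⟩
  refine (measure_mono hsub).trans ((measure_union_le _ _).trans ?_)
  gcongr
  have hD := doob_sq_maximal_ineq_of_continuous (martingale_integral_brownian H')
    (memLp_two_integral_brownian H')
    (ae_of_all _ fun ω ↦ H'.continuous_integral (continuous_brownian ω)) hε t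
    (μ := preWienerMeasure)
  refine hD.trans (ENNReal.ofReal_le_ofReal (div_le_div_of_nonneg_right ?_ (sq_nonneg ε)))
  rw [itoIsometry_simple_holds H' t]
  calc ∫ ω, (∫ s in Set.Icc (0 : ℝ) t, (H'.toProcess s.toNNReal ω) ^ 2) ∂preWienerMeasure
      ≤ ∫ _, η ∂preWienerMeasure :=
        integral_mono_of_nonneg (ae_of_all _ fun ω ↦ integral_nonneg fun s ↦ sq_nonneg _)
          (integrable_const η)
          (ae_of_all _ fun ω ↦ H.setIntegral_toProcess_truncate_sq_le t hη.le ω)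
    _ = η := by simp

/-- **Differences of elementary integrals, localised**: if `H = H'` on `[0, t]` for every `ω ∈ E`
and `H` has a.s. Borel paths, then for bounded simple `Hₙ, Gₙ` and `ε, η > 0`,
`P(E ∩ {∃ s ≤ t, ε ≤ |(Hₙ·B)_s - (Gₙ·B)_s|}) ≤ P(∫₀ᵗ(Hₙ-H)² ≥ η/4) + P(∫₀ᵗ(Gₙ-H')² ≥ η/4) + η/ε²`
(`measure_inter_sup_integral_ge_le_brownian` for `Hₙ - Gₙ`, and
`∫₀ᵗ (Hₙ - Gₙ)² ≤ 2∫₀ᵗ (Hₙ - H)² + 2∫₀ᵗ (Gₙ - H)²` with `H = H'` on `[0, t] × E`).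
Revuz–Yor, *Continuous Martingales and Brownian Motion* (1999), Ch. IV, Prop. (2.11) and
Thm (2.12). [folklore] -/
theorem measure_inter_sup_integral_sub_ge_le_brownian
    (Hn Gn : SimpleProcess (inferInstance : MeasurableSpace (ℝ≥0 → ℝ)) RandomPlanarGeometry.brownianFiltration)
    {H H' : ℝ≥0 → (ℝ≥0 → ℝ) → ℝ}
    (hH : ∀ᵐ ω ∂preWienerMeasure, Measurable fun s : ℝ ↦ H s.toNNReal ω)
    {E : Set (ℝ≥0 → ℝ)} {t : ℝ≥0} (hE : ∀ ω ∈ E, ∀ s ≤ t, H s ω = H' s ω)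
    {ε η : ℝ} (hε : 0 < ε) (hη : 0 < η) :
    preWienerMeasure (E ∩ {ω | ∃ s ≤ t, ε ≤ |Hn.integral brownian s ω - Gn.integral brownian s ω|}) ≤
      preWienerMeasure {ω | ENNReal.ofReal (η / 4) ≤ ∫⁻ s in Set.Icc (0 : ℝ) t,
          ENNReal.ofReal ((Hn.toProcess s.toNNReal ω - H s.toNNReal ω) ^ 2)} +
        preWienerMeasure {ω | ENNReal.ofReal (η / 4) ≤ ∫⁻ s in Set.Icc (0 : ℝ) t,
          ENNReal.ofReal ((Gn.toProcess s.toNNReal ω - H' s.toNNReal ω) ^ 2)} +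
        ENNReal.ofReal (η / ε ^ 2) := by
  have h1 := measure_inter_sup_integral_ge_le_brownian (Hn.sub Gn) E hε hη t
  have heq : E ∩ {ω | ∃ s ≤ t, ε ≤ |Hn.integral brownian s ω - Gn.integral brownian s ω|} =
      E ∩ {ω | ∃ s ≤ t, ε ≤ |(Hn.sub Gn).integral brownian s ω|} := by
    ext ω; simp only [Set.mem_inter_iff, Set.mem_setOf_eq, Hn.integral_sub Gn]
  rw [heq]
  refine h1.trans ?_
  gcongr ?_ + _
  -- on `E`, the bad event for `Hₙ - Gₙ` is covered by the two bad events and the null set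
  have hsub : E ∩ {ω | η < ∫ s in Set.Icc (0 : ℝ) t, ((Hn.sub Gn).toProcess s.toNNReal ω) ^ 2} ⊆
      {ω | ENNReal.ofReal (η / 4) ≤ ∫⁻ s in Set.Icc (0 : ℝ) t,
          ENNReal.ofReal ((Hn.toProcess s.toNNReal ω - H s.toNNReal ω) ^ 2)} ∪
        {ω | ENNReal.ofReal (η / 4) ≤ ∫⁻ s in Set.Icc (0 : ℝ) t,
          ENNReal.ofReal ((Gn.toProcess s.toNNReal ω - H' s.toNNReal ω) ^ 2)} ∪
        {ω | ¬ Measurable fun s : ℝ ↦ H s.toNNReal ω} := by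
    rintro ω ⟨hωE, hω⟩
    by_contra hcon
    simp only [Set.mem_union, Set.mem_setOf_eq, not_or, not_le, not_not] at hcon
    obtain ⟨⟨hHn, hGn⟩, hm⟩ := hcon
    -- on `E`, `∫₀ᵗ (Gₙ - H)² = ∫₀ᵗ (Gₙ - H')²`
    have hGn' : ∫⁻ s in Set.Icc (0 : ℝ) t,
        ENNReal.ofReal ((Gn.toProcess s.toNNReal ω - H s.toNNReal ω) ^ 2) <
        ENNReal.ofReal (η / 4) := by
      refine lt_of_eq_of_lt (setLIntegral_congr_fun measurableSet_Icc fun s hs ↦ ?_) hGn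
      have hst : s.toNNReal ≤ t := Real.toNNReal_le_iff_le_coe.2 hs.2
      simp only [hE ω hωE _ hst]
    exact absurd (setIntegral_toProcess_sub_sq_le Hn Gn hm hη.le t hHn hGn') (not_le.2 hω)
  calc preWienerMeasure (E ∩ {ω | η < ∫ s in Set.Icc (0 : ℝ) t,
        ((Hn.sub Gn).toProcess s.toNNReal ω) ^ 2})
      ≤ _ := measure_mono hsub
    _ ≤ _ := measure_union_le _ _
    _ ≤ _ := by
        rw [show preWienerMeasure {ω | ¬ Measurable fun s : ℝ ↦ H s.toNNReal ω} = 0 from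
          ae_iff.1 hH, add_zero]
        exact measure_union_le _ _

/-! ### Local character of the Itô integral -/

/-- **Local character of the Itô integral** (Brownian integrator, raw filtration). Let
`K = ∫ H dB` and `K' = ∫ H' dB` in the sense of `IsItoIntegral`, with `H` having a.s. Borel paths,
and let `E` be any set of paths such that `H_s(ω) = H'_s(ω)` for all `s ≤ t`, `ω ∈ E`. Then almost
surely on `E`, `K_s = K'_s` for all `s ≤ t`. Proof from the characterisation: along approximating
sequences `Hₙ → H`, `Gₙ → H'` (which exist), `(Hₙ·B) → K` and `(Gₙ·B) → K'` u.c.p., while on `E`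
the differences `(Hₙ·B) - (Gₙ·B)` are u.c.p.-small
(`measure_inter_sup_integral_sub_ge_le_brownian`); so `P(E ∩ {sup_{s≤t} |K_s - K'_s| ≥ ε}) ≤ η/ε²`
for every `η > 0`, and the exceptional set is a countable union of such null sets (outer measure:
no measurability of `E` is needed).
Revuz–Yor, *Continuous Martingales and Brownian Motion* (1999), Ch. IV, Prop. (2.11): "if
`H = K` on `[0, T] × E` … then `(H·M) = (K·M)` on `[0, T] × E` a.s.".
[cite: RevuzYor1999, Ch. IV Prop. (2.11)] -/
theorem IsItoIntegral.ae_eqOn_of_brownian {H H' K K' : ℝ≥0 → (ℝ≥0 → ℝ) → ℝ}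
    (hK : IsItoIntegral H brownian K RandomPlanarGeometry.brownianFiltration preWienerMeasure)
    (hK' : IsItoIntegral H' brownian K' RandomPlanarGeometry.brownianFiltration preWienerMeasure)
    (hH : ∀ᵐ ω ∂preWienerMeasure, Measurable fun s : ℝ ↦ H s.toNNReal ω)
    {E : Set (ℝ≥0 → ℝ)} {t : ℝ≥0} (hE : ∀ ω ∈ E, ∀ s ≤ t, H s ω = H' s ω) :
    ∀ᵐ ω ∂preWienerMeasure, ω ∈ E → ∀ s ≤ t, K s ω = K' s ω := by
  haveI := RandomPlanarGeometry.isProbabilityMeasure_preWienerMeasure'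
  obtain ⟨Hn, hHn⟩ := hK.2.2.2.1
  obtain ⟨Gn, hGn⟩ := hK'.2.2.2.1
  have hucpK := hK.2.2.2.2 Hn hHn
  have hucpK' := hK'.2.2.2.2 Gn hGn
  -- Step 1: for fixed `ε > 0` and `η > 0`, `P(E ∩ {∃ s ≤ t, ε ≤ |K_s - K'_s|}) ≤ η/(ε/3)²`
  have step1 : ∀ ε : ℝ, 0 < ε → ∀ η : ℝ, 0 < η →
      preWienerMeasure (E ∩ {ω | ∃ s ≤ t, ε ≤ |K s ω - K' s ω|}) ≤
        ENNReal.ofReal (η / (ε / 3) ^ 2) := by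
    intro ε hε η hη
    have hε3 : 0 < ε / 3 := by positivity
    -- the four vanishing sequences
    set a : ℕ → ℝ≥0∞ := fun n ↦
      preWienerMeasure {ω | ∃ s ≤ t, ε / 3 ≤ |(Hn n).integral brownian s ω - K s ω|} with ha
    set d : ℕ → ℝ≥0∞ := fun n ↦
      preWienerMeasure {ω | ∃ s ≤ t, ε / 3 ≤ |(Gn n).integral brownian s ω - K' s ω|} with hd
    set b : ℕ → ℝ≥0∞ := fun n ↦ preWienerMeasure {ω | ENNReal.ofReal (η / 4) ≤
      ∫⁻ s in Set.Icc (0 : ℝ) t,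
        ENNReal.ofReal (((Hn n).toProcess s.toNNReal ω - H s.toNNReal ω) ^ 2)} with hb
    set c : ℕ → ℝ≥0∞ := fun n ↦ preWienerMeasure {ω | ENNReal.ofReal (η / 4) ≤
      ∫⁻ s in Set.Icc (0 : ℝ) t,
        ENNReal.ofReal (((Gn n).toProcess s.toNNReal ω - H' s.toNNReal ω) ^ 2)} with hc
    have ha0 : Tendsto a atTop (𝓝 0) := hucpK t (ε / 3) hε3
    have hd0 : Tendsto d atTop (𝓝 0) := hucpK' t (ε / 3) hε3
    have hb0 : Tendsto b atTop (𝓝 0) := hHn t (η / 4) (by positivity)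
    have hc0 : Tendsto c atTop (𝓝 0) := hGn t (η / 4) (by positivity)
    have hbound : ∀ n, preWienerMeasure (E ∩ {ω | ∃ s ≤ t, ε ≤ |K s ω - K' s ω|}) ≤
        a n + (b n + c n + ENNReal.ofReal (η / (ε / 3) ^ 2)) + d n := by
      intro n
      have hsub : E ∩ {ω | ∃ s ≤ t, ε ≤ |K s ω - K' s ω|} ⊆
          {ω | ∃ s ≤ t, ε / 3 ≤ |(Hn n).integral brownian s ω - K s ω|} ∪
            (E ∩ {ω | ∃ s ≤ t, ε / 3 ≤
              |(Hn n).integral brownian s ω - (Gn n).integral brownian s ω|}) ∪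
            {ω | ∃ s ≤ t, ε / 3 ≤ |(Gn n).integral brownian s ω - K' s ω|} := by
        rintro ω ⟨hωE, s, hs, hεs⟩
        by_contra hcon
        simp only [Set.mem_union, Set.mem_inter_iff, Set.mem_setOf_eq, not_or, not_exists,
          not_and, not_le] at hcon
        obtain ⟨⟨h1, h2⟩, h3⟩ := hcon
        have h1 := h1 s hs
        have h2 := h2 hωE s hs
        have h3 := h3 s hs
        have htri : |K s ω - K' s ω| ≤ |(Hn n).integral brownian s ω - K s ω| +
            |(Hn n).integral brownian s ω - (Gn n).integral brownian s ω| +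
            |(Gn n).integral brownian s ω - K' s ω| := by
          have e : K s ω - K' s ω = -((Hn n).integral brownian s ω - K s ω) +
              ((Hn n).integral brownian s ω - (Gn n).integral brownian s ω) +
              ((Gn n).integral brownian s ω - K' s ω) := by ring
          rw [e]
          refine (abs_add_le _ _).trans (add_le_add ((abs_add_le _ _).trans ?_) le_rfl)
          rw [abs_neg]
        linarith
      calc preWienerMeasure (E ∩ {ω | ∃ s ≤ t, ε ≤ |K s ω - K' s ω|})
          ≤ preWienerMeasure ({ω | ∃ s ≤ t, ε / 3 ≤ |(Hn n).integral brownian s ω - K s ω|} ∪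
              (E ∩ {ω | ∃ s ≤ t, ε / 3 ≤
                |(Hn n).integral brownian s ω - (Gn n).integral brownian s ω|})) +
            preWienerMeasure {ω | ∃ s ≤ t, ε / 3 ≤ |(Gn n).integral brownian s ω - K' s ω|} :=
            (measure_mono hsub).trans (measure_union_le _ _)
        _ ≤ a n + preWienerMeasure (E ∩ {ω | ∃ s ≤ t, ε / 3 ≤
                |(Hn n).integral brownian s ω - (Gn n).integral brownian s ω|}) + d n := by
            gcongr
            exact measure_union_le _ _
        _ ≤ a n + (b n + c n + ENNReal.ofReal (η / (ε / 3) ^ 2)) + d n := by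
            gcongr
            exact measure_inter_sup_integral_sub_ge_le_brownian (Hn n) (Gn n) hH hE hε3 hη
    have hlim : Tendsto (fun n ↦ a n + (b n + c n + ENNReal.ofReal (η / (ε / 3) ^ 2)) + d n)
        atTop (𝓝 (0 + (0 + 0 + ENNReal.ofReal (η / (ε / 3) ^ 2)) + 0)) :=
      (ha0.add ((hb0.add hc0).add tendsto_const_nhds)).add hd0
    simp only [zero_add, add_zero] at hlim
    exact ge_of_tendsto' hlim hbound
  -- Step 2: for fixed `ε > 0` the event is null
  have step2 : ∀ ε : ℝ, 0 < ε →
      preWienerMeasure (E ∩ {ω | ∃ s ≤ t, ε ≤ |K s ω - K' s ω|}) = 0 := by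
    intro ε hε
    refine nonpos_iff_eq_zero.1 ?_
    have hlim : Tendsto (fun k : ℕ ↦ ENNReal.ofReal ((1 / ((k : ℝ) + 1)) / (ε / 3) ^ 2))
        atTop (𝓝 0) := by
      rw [← ENNReal.ofReal_zero]
      refine ENNReal.tendsto_ofReal ?_
      rw [show (0 : ℝ) = 0 / (ε / 3) ^ 2 by simp]
      exact tendsto_one_div_add_atTop_nhds_zero_nat.div_const _
    exact ge_of_tendsto' hlim fun k ↦ step1 ε hε _ (by positivity)
  -- Step 3: countable union over `ε = 1/(k+1)`
  rw [ae_iff]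
  have hsub : {ω | ¬(ω ∈ E → ∀ s ≤ t, K s ω = K' s ω)} ⊆
      ⋃ k : ℕ, E ∩ {ω | ∃ s ≤ t, 1 / ((k : ℝ) + 1) ≤ |K s ω - K' s ω|} := by
    intro ω hω
    simp only [Set.mem_setOf_eq, Classical.not_imp, not_forall] at hω
    obtain ⟨hωE, s, hs, hne⟩ := hω
    have hpos : 0 < |K s ω - K' s ω| := abs_pos.2 (sub_ne_zero.2 hne)
    obtain ⟨k, hk⟩ := exists_nat_one_div_lt hpos
    simp only [Set.mem_iUnion, Set.mem_inter_iff, Set.mem_setOf_eq]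
    exact ⟨k, hωE, s, hs, hk.le⟩
  exact measure_mono_null hsub <| (measure_iUnion_null_iff).2 fun k ↦ step2 _ (by positivity)

/-! ### Itô integrals of constant integrands -/

namespace SimpleProcess

variable {Ω : Type*} {m : MeasurableSpace Ω} {𝓕 : Filtration ℝ≥0 m}

/-- The one-step simple process `c 𝟙_{(0, n+1]}` (partition `0 < n + 1`, constant value `c`).
Revuz–Yor, *Continuous Martingales and Brownian Motion* (1999), Ch. IV, Def. (2.3). [folklore] -/
def constStep (m : MeasurableSpace Ω) (𝓕 : Filtration ℝ≥0 m) (c : ℝ) (n : ℕ) :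
    SimpleProcess m 𝓕 where
  times := [0, (n : ℝ≥0) + 1]
  sorted := (List.pairwise_pair.2 (by positivity)).sortedLT
  value _ _ := c
  measurable _ _ := stronglyMeasurable_const
  bounded := ⟨|c|, fun _ _ ↦ le_rfl⟩

/-- The step process of `c 𝟙_{(0, n+1]}` equals `c` on `(0, n + 1]`.
Revuz–Yor, *Continuous Martingales and Brownian Motion* (1999), Ch. IV, Def. (2.3). [folklore] -/
theorem toProcess_constStep_of_mem (c : ℝ) (n : ℕ) {s : ℝ≥0} (hs : s ∈ Set.Ioc (0 : ℝ≥0) (n + 1))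
    (ω : Ω) : (constStep m 𝓕 c n).toProcess s ω = c := by
  simp only [toProcess, constStep, time, List.length_cons, List.length_nil, zero_add,
    Nat.add_one_sub_one, Finset.sum_range_one, List.getD_cons_zero, List.getD_cons_succ]
  rw [Set.indicator_of_mem hs]

/-- The elementary integral of `c 𝟙_{(0, n+1]}` against `B` is `c (B_{t ∧ (n+1)} - B_0)`.
Revuz–Yor, *Continuous Martingales and Brownian Motion* (1999), Ch. IV, eq. (2.4). [folklore] -/
theorem integral_constStep (c : ℝ) (n : ℕ) (B : ℝ≥0 → Ω → ℝ) (t : ℝ≥0) (ω : Ω) :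
    (constStep m 𝓕 c n).integral B t ω = c * (B (min t ((n : ℝ≥0) + 1)) ω - B 0 ω) := by
  simp only [integral, constStep, time, List.length_cons, List.length_nil, zero_add,
    Nat.add_one_sub_one, Finset.sum_range_one, List.getD_cons_zero, List.getD_cons_succ]
  rw [min_eq_right (by positivity : (0 : ℝ≥0) ≤ t)]

end SimpleProcess

/-- **The Itô integral of a constant integrand**: for `c : ℝ`, the process `c B` is the Itô
integral `∫ c dB` of the constant integrand `c` against the canonical Brownian motion (raw
filtration). The one-step simple processes `c 𝟙_{(0, n+1]}` approximate `c` with zero error on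
`[0, n + 1]`, and their elementary integrals are `c B` there; the `∀ approximating sequence`
clause is `tendstoUCP_of_isApproxSeq_brownian`.
Revuz–Yor, *Continuous Martingales and Brownian Motion* (1999), Ch. IV, eq. (2.4) and
Prop. (2.10)(i) (`(c 𝟙)·B = c B`). [folklore] -/
theorem isItoIntegral_const_brownian (c : ℝ) :
    IsItoIntegral (fun _ _ ↦ c) brownian (fun t ω ↦ c * brownian t ω) RandomPlanarGeometry.brownianFiltration
      preWienerMeasure := by
  haveI := RandomPlanarGeometry.isProbabilityMeasure_preWienerMeasure'
  set Ln : ℕ → SimpleProcess (inferInstance : MeasurableSpace (ℝ≥0 → ℝ)) RandomPlanarGeometry.brownianFiltration :=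
    fun n ↦ SimpleProcess.constStep _ RandomPlanarGeometry.brownianFiltration c n with hLn
  -- the one-step processes approximate `c` exactly on `[0, n + 1]`
  have hL : SimpleProcess.IsApproxSeq Ln (fun _ _ ↦ c) preWienerMeasure := by
    intro t ε hε
    obtain ⟨N, hN⟩ := exists_nat_ge (t : ℝ)
    refine tendsto_const_nhds.congr' ?_
    filter_upwards [Filter.eventually_ge_atTop N] with n hn
    have htn : (t : ℝ≥0) ≤ (n : ℝ≥0) + 1 := by
      have : (t : ℝ) ≤ n + 1 := (hN.trans (Nat.cast_le.2 hn)).trans (le_add_of_nonneg_right zero_le_one)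
      exact_mod_cast this
    have hzero : ∀ ω : ℝ≥0 → ℝ, ∫⁻ s in Set.Icc (0 : ℝ) t,
        ENNReal.ofReal (((Ln n).toProcess s.toNNReal ω - (fun _ _ ↦ c) s.toNNReal ω) ^ 2) = 0 := by
      intro ω
      rw [setLIntegral_congr (Ioc_ae_eq_Icc (a := (0 : ℝ)) (b := (t : ℝ)) (μ := volume)).symm]
      refine setLIntegral_eq_zero measurableSet_Ioc fun s hs ↦ ?_
      have hs' : s.toNNReal ∈ Set.Ioc (0 : ℝ≥0) ((n : ℝ≥0) + 1) := by
        refine ⟨Real.toNNReal_pos.2 hs.1, ?_⟩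
        exact (Real.toNNReal_le_iff_le_coe.2 hs.2).trans htn
      simp only [hLn, SimpleProcess.toProcess_constStep_of_mem c n hs', sub_self,
        ne_eq, OfNat.ofNat_ne_zero, not_false_eq_true, zero_pow, ENNReal.ofReal_zero,
        Pi.zero_apply]
    have hset : {ω : ℝ≥0 → ℝ | ENNReal.ofReal ε ≤ ∫⁻ s in Set.Icc (0 : ℝ) t,
        ENNReal.ofReal (((Ln n).toProcess s.toNNReal ω - (fun _ _ ↦ c) s.toNNReal ω) ^ 2)} = ∅ := by
      ext ω
      simp only [hzero ω, nonpos_iff_eq_zero, ENNReal.ofReal_eq_zero, not_le.2 hε,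
        Set.mem_setOf_eq, Set.mem_empty_iff_false]
    simp only [hset, measure_empty]
  -- their elementary integrals are `c B` on `[0, n + 1]`
  have hJ : TendstoUCP (fun n ↦ (Ln n).integral brownian) (fun t ω ↦ c * brownian t ω)
      preWienerMeasure := by
    intro t ε hε
    obtain ⟨N, hN⟩ := exists_nat_ge (t : ℝ)
    refine tendsto_const_nhds.congr' ?_
    filter_upwards [Filter.eventually_ge_atTop N] with n hn
    have htn : (t : ℝ≥0) ≤ (n : ℝ≥0) + 1 := by
      have : (t : ℝ) ≤ n + 1 := (hN.trans (Nat.cast_le.2 hn)).trans (le_add_of_nonneg_right zero_le_one)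
      exact_mod_cast this
    have hset : {ω : ℝ≥0 → ℝ | ∃ s ≤ t, ε ≤ |(Ln n).integral brownian s ω - c * brownian s ω|} = ∅ := by
      ext ω
      simp only [Set.mem_setOf_eq, Set.mem_empty_iff_false, iff_false, not_exists, not_and, not_le]
      intro s hs
      rw [hLn, SimpleProcess.integral_constStep, min_eq_left (hs.trans htn)]
      simp [hε]
    simp only [hset, measure_empty]
  have hmart : Martingale (fun t ω ↦ c * brownian t ω) RandomPlanarGeometry.brownianFiltration preWienerMeasure :=
    RandomPlanarGeometry.martingale_brownian_holds.smul c
  refine ⟨fun ω ↦ by simp, ae_of_all _ fun ω ↦ continuous_const.mul (continuous_brownian ω),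
    hmart.isLocalMartingale, ⟨Ln, hL⟩, fun Hn hHn ↦
    tendstoUCP_of_isApproxSeq_brownian (ae_of_all _ fun ω ↦ measurable_const) hL hHn hJ⟩

end Literature.Probability.Process
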